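import Mathlib
import Summits.NavierStokesRegularity.NavierStokesRegularity.Theses.FilamentSkeletonRss

/-!
# Strain (ellipticity) certificate of the elliptic C₄ datum `D*`
(crux `CoreGluing`, line `Sketch`, stub `stub_ellipticDatumStrainCertificate`)

Along filament `0` of the explicit C₄ skew-line configuration `D*` (`P₀ = (−2, −3/2, −2)`,
`e₀ = (6,3,2)/7`, `α = 1`, `γ/2π = 1`) the symmetric cross strain of the rescaled skeleton field at
`x = P₀ + t e₀`, written in the orthogonal basis `u₁ = (13,−18,−12)`, `u₂ = (0,14,−21)` of `e₀^⊥`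
(`‖u₁‖² = ‖u₂‖² = 637`), has the explicit rational entries `S₁₁, S₁₂, S₂₂` of the statement: a
constant plus three terms `Nₖ(t)/Dₖ(t)²` with quadratic numerators over the squares of the three
image-line denominators `D₁ = 9540t² − 56532t + 84329`, `D₂ = 720t² − 3696t + 6664`,
`D₃ = 9540t² − 41412t + 45521`.  This file proves that on the stagnation window `[3/2, 8/5]` the
form `a²S₁₁ + 2abS₁₂ + b²S₂₂` is bounded by `−(637/10)(a² + b²)`: the cross strain is negative
definite with margin `1/10` (elliptic core).

Everything is univariate real algebra with rational data.  The `Dₖ` are positive quadratics with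
vertices `> 8/5`, hence decreasing on the window; on a piece `[p, q]` one has
`Dₖ(q) ≤ Dₖ(t) ≤ Dₖ(p)` and each numerator is enclosed by its midpoint tangent plus the square
term (`quad_le4`), so every term `Nₖ/Dₖ²` is bounded by an integer constant on the piece
(`frac_le`, `frac_ge`, side conditions discharged by `norm_num`).  Four pieces of width `1/40`
suffice; on each, the resulting constant bounds `S₁₁ + 637/10 ≤ P₀ < 0`, `S₂₂ + 637/10 ≤ R₀ < 0`,
`|S₁₂| ≤ B` with `B² ≤ P₀ R₀` give negative semidefiniteness of the shifted `2 × 2` form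
(`form_le`).  Same pattern as `Theorems/FilamentSkeletonRssSkeletonEquilibriumInnerCertificate.lean`.
-/

set_option linter.dupNamespace false

noncomputable section

namespace Summit.NavierStokesRegularity.NavierStokesRegularity.Theorems

/-- The first image-line denominator `9540t² − 56532t + 84329` is positive
(`9540 · D₁ = (9540t − 28266)² + 5531904`). -/
private theorem strainD1_pos (s : ℝ) : 0 < 9540 * s ^ 2 - 56532 * s + 84329 := by
  nlinarith [sq_nonneg (9540 * s - 28266)]

/-- The second image-line denominator `720t² − 3696t + 6664` is positive
(`720 · D₂ = (720t − 1848)² + 1382976`). -/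
private theorem strainD2_pos (s : ℝ) : 0 < 720 * s ^ 2 - 3696 * s + 6664 := by
  nlinarith [sq_nonneg (720 * s - 1848)]

/-- The third image-line denominator `9540t² − 41412t + 45521` is positive
(`9540 · D₃ = (9540t − 20706)² + 5531904`). -/
private theorem strainD3_pos (s : ℝ) : 0 < 9540 * s ^ 2 - 41412 * s + 45521 := by
  nlinarith [sq_nonneg (9540 * s - 20706)]

/-- Upper bound of a quadratic `N(s) = a s² + b s + c` on a piece `[p, q]`.  With `m = (p+q)/2`,
`h = (q−p)/2` and `ℓ` the tangent of `N` at `m` one has `N(t) = ℓ(t) + a (t − m)²` and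
`0 ≤ (t − m)² ≤ h²`, so `N(t) ≤ max(ℓ(p), ℓ(q)) + A h²` for any `A ≥ max(a, 0)`.  The two
hypotheses are `4 (ℓ(p) + A h²) ≤ 4M` and `4 (ℓ(q) + A h²) ≤ 4M`, written without fractions. -/
private theorem quad_le4 {a b c A p q t M : ℝ} (hA : a ≤ A) (hA0 : 0 ≤ A) (hp : p ≤ t)
    (hq : t ≤ q) (hpq : p < q)
    (hMp : a * (p + q) ^ 2 + 2 * b * (p + q) + 4 * c - 2 * (a * (p + q) + b) * (q - p)
      + A * (q - p) ^ 2 ≤ 4 * M)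
    (hMq : a * (p + q) ^ 2 + 2 * b * (p + q) + 4 * c + 2 * (a * (p + q) + b) * (q - p)
      + A * (q - p) ^ 2 ≤ 4 * M) :
    a * t ^ 2 + b * t + c ≤ M := by
  have hu : 0 ≤ t - p := sub_nonneg.2 hp
  have hv : 0 ≤ q - t := sub_nonneg.2 hq
  have key : (q - p) * (4 * (M - (a * t ^ 2 + b * t + c)))
      = (q - t) * (4 * M - (a * (p + q) ^ 2 + 2 * b * (p + q) + 4 * c
            - 2 * (a * (p + q) + b) * (q - p) + A * (q - p) ^ 2))
        + (t - p) * (4 * M - (a * (p + q) ^ 2 + 2 * b * (p + q) + 4 * c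
            + 2 * (a * (p + q) + b) * (q - p) + A * (q - p) ^ 2))
        + (q - p) * (4 * A * ((t - p) * (q - t)) + (A - a) * ((t - p) - (q - t)) ^ 2) := by
    ring
  have h3 : 0 ≤ (q - p) * (4 * A * ((t - p) * (q - t)) + (A - a) * ((t - p) - (q - t)) ^ 2) :=
    mul_nonneg (sub_nonneg.2 hpq.le) (add_nonneg
      (mul_nonneg (mul_nonneg (by norm_num) hA0) (mul_nonneg hu hv))
      (mul_nonneg (sub_nonneg.2 hA) (sq_nonneg _)))
  have h0 : 0 ≤ (q - p) * (4 * (M - (a * t ^ 2 + b * t + c))) := by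
    rw [key]
    have h1 := mul_nonneg hv (sub_nonneg.2 hMp)
    have h2 := mul_nonneg hu (sub_nonneg.2 hMq)
    linarith
  have h4 : 0 ≤ 4 * (M - (a * t ^ 2 + b * t + c)) :=
    (mul_nonneg_iff_of_pos_left (sub_pos.2 hpq)).1 h0
  linarith

/-- Lower bound of a quadratic on a piece `[p, q]`: `quad_le4` applied to `−N`, with
`A ≥ max(−a, 0)`. -/
private theorem quad_ge4 {a b c A p q t M : ℝ} (hA : -a ≤ A) (hA0 : 0 ≤ A) (hp : p ≤ t)
    (hq : t ≤ q) (hpq : p < q)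
    (hMp : 4 * M ≤ a * (p + q) ^ 2 + 2 * b * (p + q) + 4 * c - 2 * (a * (p + q) + b) * (q - p)
      - A * (q - p) ^ 2)
    (hMq : 4 * M ≤ a * (p + q) ^ 2 + 2 * b * (p + q) + 4 * c + 2 * (a * (p + q) + b) * (q - p)
      - A * (q - p) ^ 2) :
    M ≤ a * t ^ 2 + b * t + c := by
  have := quad_le4 (a := -a) (b := -b) (c := -c) (M := -M) (by linarith) hA0 hp hq hpq
    (by linarith) (by linarith)
  linarith

/-- Upper bound `N(t)/D(t)² ≤ U` for one term on a piece `[p, q]` of the window.  The denominator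
`D(s) = α s² − β s + γ` (`α ≥ 0`, positive) is decreasing up to `q` (`2αq ≤ β`), so
`D(q) ≤ D(t) ≤ D(p)`; and `N(t) ≤ U·D(q)²`, `N(t) ≤ U·D(p)²` (each checked by `quad_le4`) give
`N(t) ≤ U·D(t)²` whatever the sign of `U`.  All numeric side conditions are bundled in `h`
(discharged by `norm_num` at each call); `A ≥ max(a, 0)` is passed explicitly. -/
private theorem frac_le {a b c α β γ p q t U : ℝ} (A : ℝ)
    (hD : ∀ s : ℝ, 0 < α * s ^ 2 - β * s + γ) (hp : p ≤ t) (hq : t ≤ q)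
    (h : 0 ≤ α ∧ a ≤ A ∧ 0 ≤ A ∧ p < q ∧ 2 * α * q ≤ β ∧
      a * (p + q) ^ 2 + 2 * b * (p + q) + 4 * c - 2 * (a * (p + q) + b) * (q - p)
        + A * (q - p) ^ 2 ≤ 4 * (U * (α * q ^ 2 - β * q + γ) ^ 2) ∧
      a * (p + q) ^ 2 + 2 * b * (p + q) + 4 * c + 2 * (a * (p + q) + b) * (q - p)
        + A * (q - p) ^ 2 ≤ 4 * (U * (α * q ^ 2 - β * q + γ) ^ 2) ∧
      a * (p + q) ^ 2 + 2 * b * (p + q) + 4 * c - 2 * (a * (p + q) + b) * (q - p)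
        + A * (q - p) ^ 2 ≤ 4 * (U * (α * p ^ 2 - β * p + γ) ^ 2) ∧
      a * (p + q) ^ 2 + 2 * b * (p + q) + 4 * c + 2 * (a * (p + q) + b) * (q - p)
        + A * (q - p) ^ 2 ≤ 4 * (U * (α * p ^ 2 - β * p + γ) ^ 2)) :
    (a * t ^ 2 + b * t + c) / (α * t ^ 2 - β * t + γ) ^ 2 ≤ U := by
  obtain ⟨hα, hA, hA0, hpq, hder, c1, c2, c3, c4⟩ := h
  have hDq : α * q ^ 2 - β * q + γ ≤ α * t ^ 2 - β * t + γ := by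
    have h1 := mul_nonneg hα (sq_nonneg (t - q))
    have h2 := mul_nonneg_of_nonpos_of_nonpos (sub_nonpos.2 hder) (sub_nonpos.2 hq)
    linarith
  have hDp : α * t ^ 2 - β * t + γ ≤ α * p ^ 2 - β * p + γ := by
    have h1 := mul_le_mul_of_nonneg_left (show p + t ≤ q + q by linarith) hα
    have h2 := mul_nonneg_of_nonpos_of_nonpos (sub_nonpos.2 hp)
      (by linarith : α * (p + t) - β ≤ 0)
    linarith
  have hN1 := quad_le4 hA hA0 hp hq hpq c1 c2
  have hN2 := quad_le4 hA hA0 hp hq hpq c3 c4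
  rw [div_le_iff₀ (pow_pos (hD t) 2)]
  rcases le_total 0 U with hU | hU
  · exact hN1.trans (mul_le_mul_of_nonneg_left (pow_le_pow_left₀ (hD q).le hDq 2) hU)
  · exact hN2.trans (mul_le_mul_of_nonpos_left (pow_le_pow_left₀ (hD t).le hDp 2) hU)

/-- Lower bound `L ≤ N(t)/D(t)²` for one term on a piece `[p, q]` of the window (mirror image of
`frac_le`, via `quad_ge4`); `A ≥ max(−a, 0)` is passed explicitly, the numeric side conditions are
bundled in `h`. -/
private theorem frac_ge {a b c α β γ p q t L : ℝ} (A : ℝ)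
    (hD : ∀ s : ℝ, 0 < α * s ^ 2 - β * s + γ) (hp : p ≤ t) (hq : t ≤ q)
    (h : 0 ≤ α ∧ -a ≤ A ∧ 0 ≤ A ∧ p < q ∧ 2 * α * q ≤ β ∧
      4 * (L * (α * q ^ 2 - β * q + γ) ^ 2) ≤ a * (p + q) ^ 2 + 2 * b * (p + q) + 4 * c
        - 2 * (a * (p + q) + b) * (q - p) - A * (q - p) ^ 2 ∧
      4 * (L * (α * q ^ 2 - β * q + γ) ^ 2) ≤ a * (p + q) ^ 2 + 2 * b * (p + q) + 4 * c
        + 2 * (a * (p + q) + b) * (q - p) - A * (q - p) ^ 2 ∧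
      4 * (L * (α * p ^ 2 - β * p + γ) ^ 2) ≤ a * (p + q) ^ 2 + 2 * b * (p + q) + 4 * c
        - 2 * (a * (p + q) + b) * (q - p) - A * (q - p) ^ 2 ∧
      4 * (L * (α * p ^ 2 - β * p + γ) ^ 2) ≤ a * (p + q) ^ 2 + 2 * b * (p + q) + 4 * c
        + 2 * (a * (p + q) + b) * (q - p) - A * (q - p) ^ 2) :
    L ≤ (a * t ^ 2 + b * t + c) / (α * t ^ 2 - β * t + γ) ^ 2 := by
  obtain ⟨hα, hA, hA0, hpq, hder, c1, c2, c3, c4⟩ := h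
  have hDq : α * q ^ 2 - β * q + γ ≤ α * t ^ 2 - β * t + γ := by
    have h1 := mul_nonneg hα (sq_nonneg (t - q))
    have h2 := mul_nonneg_of_nonpos_of_nonpos (sub_nonpos.2 hder) (sub_nonpos.2 hq)
    linarith
  have hDp : α * t ^ 2 - β * t + γ ≤ α * p ^ 2 - β * p + γ := by
    have h1 := mul_le_mul_of_nonneg_left (show p + t ≤ q + q by linarith) hα
    have h2 := mul_nonneg_of_nonpos_of_nonpos (sub_nonpos.2 hp)
      (by linarith : α * (p + t) - β ≤ 0)
    linarith
  have hN1 := quad_ge4 hA hA0 hp hq hpq c1 c2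
  have hN2 := quad_ge4 hA hA0 hp hq hpq c3 c4
  rw [le_div_iff₀ (pow_pos (hD t) 2)]
  rcases le_total 0 L with hL | hL
  · exact (mul_le_mul_of_nonneg_left (pow_le_pow_left₀ (hD t).le hDp 2) hL).trans hN2
  · exact (mul_le_mul_of_nonpos_left (pow_le_pow_left₀ (hD q).le hDq 2) hL).trans hN1

/-- The `2 × 2` step.  If `s₁₁ = 637/2 + T₁ + T₂ + T₃`, `s₁₂ = 0 + T₄ + T₅ + T₆`,
`s₂₂ = 637/2 + T₇ + T₈ + T₉` with `Tᵢ ≤ Uᵢ` (and `Lᵢ ≤ Tᵢ` for the off-diagonal terms), and the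
constants satisfy `P₀ := 637/2 + 637/10 + U₁ + U₂ + U₃ < 0`, `R₀ := 637/2 + 637/10 + U₇ + U₈ + U₉ < 0`,
`−B ≤ L₄ + L₅ + L₆`, `U₄ + U₅ + U₆ ≤ B`, `B² ≤ P₀ R₀`, then with `P = s₁₁ + 637/10 ≤ P₀`,
`R = s₂₂ + 637/10 ≤ R₀`, `Q = s₁₂`: `Q² ≤ B² ≤ P₀R₀ ≤ PR` and
`P (P x² + 2Q xy + R y²) = (P x + Q y)² + (PR − Q²) y² ≥ 0` with `P < 0`. -/
private theorem form_le
    {s₁₁ s₁₂ s₂₂ x y T₁ T₂ T₃ T₄ T₅ T₆ T₇ T₈ T₉ U₁ U₂ U₃ U₄ U₅ U₆ L₄ L₅ L₆ U₇ U₈ U₉ B : ℝ}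
    (h11 : s₁₁ = 637 / 2 + T₁ + T₂ + T₃) (h12 : s₁₂ = 0 + T₄ + T₅ + T₆)
    (h22 : s₂₂ = 637 / 2 + T₇ + T₈ + T₉)
    (e1 : T₁ ≤ U₁) (e2 : T₂ ≤ U₂) (e3 : T₃ ≤ U₃) (e4 : T₄ ≤ U₄) (e5 : T₅ ≤ U₅) (e6 : T₆ ≤ U₆)
    (l4 : L₄ ≤ T₄) (l5 : L₅ ≤ T₅) (l6 : L₆ ≤ T₆) (e7 : T₇ ≤ U₇) (e8 : T₈ ≤ U₈) (e9 : T₉ ≤ U₉)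
    (hfin : 637 / 2 + 637 / 10 + U₁ + U₂ + U₃ < 0 ∧ 637 / 2 + 637 / 10 + U₇ + U₈ + U₉ < 0 ∧
      -B ≤ L₄ + L₅ + L₆ ∧ U₄ + U₅ + U₆ ≤ B ∧
      B ^ 2 ≤ (637 / 2 + 637 / 10 + U₁ + U₂ + U₃) * (637 / 2 + 637 / 10 + U₇ + U₈ + U₉)) :
    x ^ 2 * s₁₁ + 2 * x * y * s₁₂ + y ^ 2 * s₂₂ ≤ -(637 / 10 : ℝ) * (x ^ 2 + y ^ 2) := by
  obtain ⟨hP0, hR0, hBl, hBu, hdet⟩ := hfin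
  have hPle : s₁₁ + 637 / 10 ≤ 637 / 2 + 637 / 10 + U₁ + U₂ + U₃ := by linarith
  have hRle : s₂₂ + 637 / 10 ≤ 637 / 2 + 637 / 10 + U₇ + U₈ + U₉ := by linarith
  have hP : s₁₁ + 637 / 10 < 0 := by linarith
  have hQ2 : s₁₂ ^ 2 ≤ B ^ 2 := by
    have := mul_nonneg (by linarith : 0 ≤ B - s₁₂) (by linarith : 0 ≤ B + s₁₂)
    nlinarith
  have hPR : (637 / 2 + 637 / 10 + U₁ + U₂ + U₃) * (637 / 2 + 637 / 10 + U₇ + U₈ + U₉)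
      ≤ (s₁₁ + 637 / 10) * (s₂₂ + 637 / 10) := by
    have h1 := mul_nonneg_of_nonpos_of_nonpos hP.le (sub_nonpos.2 hRle)
    have h2 := mul_nonneg_of_nonpos_of_nonpos hR0.le (sub_nonpos.2 hPle)
    linarith
  have key : (s₁₁ + 637 / 10)
        * (x ^ 2 * s₁₁ + 2 * x * y * s₁₂ + y ^ 2 * s₂₂ + 637 / 10 * (x ^ 2 + y ^ 2))
      = ((s₁₁ + 637 / 10) * x + s₁₂ * y) ^ 2
        + ((s₁₁ + 637 / 10) * (s₂₂ + 637 / 10) - s₁₂ ^ 2) * y ^ 2 := by ring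
  have h0 : 0 ≤ (s₁₁ + 637 / 10)
      * (x ^ 2 * s₁₁ + 2 * x * y * s₁₂ + y ^ 2 * s₂₂ + 637 / 10 * (x ^ 2 + y ^ 2)) := by
    rw [key]
    exact add_nonneg (sq_nonneg _) (mul_nonneg (by linarith) (sq_nonneg _))
  by_contra hcon
  have hpos : 0 < x ^ 2 * s₁₁ + 2 * x * y * s₁₂ + y ^ 2 * s₂₂ + 637 / 10 * (x ^ 2 + y ^ 2) := by
    linarith [not_le.1 hcon]
  linarith [mul_neg_of_neg_of_pos hP hpos]

/-- **Certificate (ellipticity).** On the stagnation window `[3/2, 8/5]` of the datum `D*` the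
symmetric cross strain is NEGATIVE DEFINITE with margin `1/10` (in units of `‖u₁‖² = ‖u₂‖² = 637`):
`a²S₁₁ + 2abS₁₂ + b²S₂₂ ≤ −(637/10)(a² + b²)`, i.e. both cross-plane principal strains `≤ −1/10`
(elliptic core; with the axial slope `≥ 2` this is Burgers-dressing asymmetry `λ < 1`).  Proof:
four pieces `[3/2, 61/40]`, `[61/40, 31/20]`, `[31/20, 63/40]`, `[63/40, 8/5]`; on each, integer
bounds of the nine terms by `frac_le` / `frac_ge` and the `2 × 2` step `form_le`, all side
conditions by `norm_num`. -/
theorem stub_ellipticDatumStrainCertificate :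
    ∀ (S₁₁ S₁₂ S₂₂ : ℝ → ℝ), (∀ t, S₁₁ t = (637 / 2 : ℝ) + (((-2207229696) : ℝ) * t ^ 2 + (14535999744 : ℝ) * t + ((-23557766848) : ℝ)) / (9540 * t ^ 2 - 56532 * t + 84329) ^ 2 + (((-793828224) : ℝ) * t ^ 2 + (6166805232 : ℝ) * t + ((-8480812200) : ℝ)) / (720 * t ^ 2 - 3696 * t + 6664) ^ 2 + (((-4762969344) : ℝ) * t ^ 2 + (35317519104 : ℝ) * t + ((-53927612480) : ℝ)) / (9540 * t ^ 2 - 41412 * t + 45521) ^ 2) →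
      (∀ t, S₁₂ t = (0 : ℝ) + (((-4222225728) : ℝ) * t ^ 2 + (31730540352 : ℝ) * t + ((-56691758928) : ℝ)) / (9540 * t ^ 2 - 56532 * t + 84329) ^ 2 + (((-467791632) : ℝ) * t ^ 2 + ((-233146704) : ℝ) * t + (4928081312 : ℝ)) / (720 * t ^ 2 - 3696 * t + 6664) ^ 2 + ((114787008 : ℝ) * t ^ 2 + (13982348352 : ℝ) * t + ((-30895568592) : ℝ)) / (9540 * t ^ 2 - 41412 * t + 45521) ^ 2) →
      (∀ t, S₂₂ t = (637 / 2 : ℝ) + ((2207229696 : ℝ) * t ^ 2 + (14050114176 : ℝ) * t + ((-61139832320) : ℝ)) / (9540 * t ^ 2 - 56532 * t + 84329) ^ 2 + ((793828224 : ℝ) * t ^ 2 + ((-5088083952) : ℝ) * t + (5712094248 : ℝ)) / (720 * t ^ 2 - 3696 * t + 6664) ^ 2 + ((4762969344 : ℝ) * t ^ 2 + ((-6731405184) : ℝ) * t + ((-8116839808) : ℝ)) / (9540 * t ^ 2 - 41412 * t + 45521) ^ 2) →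
      ∀ t ∈ Set.Icc (3 / 2 : ℝ) (8 / 5), ∀ a b : ℝ,
        a ^ 2 * S₁₁ t + 2 * a * b * S₁₂ t + b ^ 2 * S₂₂ t ≤ -(637 / 10 : ℝ) * (a ^ 2 + b ^ 2) := by
  intro S₁₁ S₁₂ S₂₂ hS₁₁ hS₁₂ hS₂₂ t ht a b
  rcases le_or_gt t (61 / 40) with h₁ | h₁
  · -- piece `[3/2, 61/40]`
    exact form_le (U₁ := -14) (U₂ := -122) (U₃ := -470) (U₄ := -41) (U₅ := 483) (U₆ := -392)
      (L₄ := -46) (L₅ := 464) (L₆ := -466) (U₇ := -78) (U₈ := -17) (U₉ := -308) (B := 50)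
      (hS₁₁ t) (hS₁₂ t) (hS₂₂ t)
      (frac_le 0 strainD1_pos ht.1 h₁ (by norm_num)) (frac_le 0 strainD2_pos ht.1 h₁ (by norm_num))
      (frac_le 0 strainD3_pos ht.1 h₁ (by norm_num)) (frac_le 0 strainD1_pos ht.1 h₁ (by norm_num))
      (frac_le 0 strainD2_pos ht.1 h₁ (by norm_num))
      (frac_le 114787008 strainD3_pos ht.1 h₁ (by norm_num))
      (frac_ge 4222225728 strainD1_pos ht.1 h₁ (by norm_num))
      (frac_ge 467791632 strainD2_pos ht.1 h₁ (by norm_num))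
      (frac_ge 0 strainD3_pos ht.1 h₁ (by norm_num))
      (frac_le 2207229696 strainD1_pos ht.1 h₁ (by norm_num))
      (frac_le 793828224 strainD2_pos ht.1 h₁ (by norm_num))
      (frac_le 4762969344 strainD3_pos ht.1 h₁ (by norm_num)) (by norm_num)
  rcases le_or_gt t (31 / 20) with h₂ | h₂
  · -- piece `[61/40, 31/20]`
    exact form_le (U₁ := -15) (U₂ := -113) (U₃ := -512) (U₄ := -42) (U₅ := 491) (U₆ := -431)
      (L₄ := -48) (L₅ := 471) (L₆ := -515) (U₇ := -82) (U₈ := -27) (U₉ := -342) (B := 92)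
      (hS₁₁ t) (hS₁₂ t) (hS₂₂ t)
      (frac_le 0 strainD1_pos h₁.le h₂ (by norm_num)) (frac_le 0 strainD2_pos h₁.le h₂ (by norm_num))
      (frac_le 0 strainD3_pos h₁.le h₂ (by norm_num)) (frac_le 0 strainD1_pos h₁.le h₂ (by norm_num))
      (frac_le 0 strainD2_pos h₁.le h₂ (by norm_num))
      (frac_le 114787008 strainD3_pos h₁.le h₂ (by norm_num))
      (frac_ge 4222225728 strainD1_pos h₁.le h₂ (by norm_num))
      (frac_ge 467791632 strainD2_pos h₁.le h₂ (by norm_num))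
      (frac_ge 0 strainD3_pos h₁.le h₂ (by norm_num))
      (frac_le 2207229696 strainD1_pos h₁.le h₂ (by norm_num))
      (frac_le 793828224 strainD2_pos h₁.le h₂ (by norm_num))
      (frac_le 4762969344 strainD3_pos h₁.le h₂ (by norm_num)) (by norm_num)
  rcases le_or_gt t (63 / 40) with h₃ | h₃
  · -- piece `[31/20, 63/40]`
    exact form_le (U₁ := -15) (U₂ := -103) (U₃ := -559) (U₄ := -44) (U₅ := 499) (U₆ := -474)
      (L₄ := -50) (L₅ := 478) (L₆ := -570) (U₇ := -87) (U₈ := -37) (U₉ := -381) (B := 142)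
      (hS₁₁ t) (hS₁₂ t) (hS₂₂ t)
      (frac_le 0 strainD1_pos h₂.le h₃ (by norm_num)) (frac_le 0 strainD2_pos h₂.le h₃ (by norm_num))
      (frac_le 0 strainD3_pos h₂.le h₃ (by norm_num)) (frac_le 0 strainD1_pos h₂.le h₃ (by norm_num))
      (frac_le 0 strainD2_pos h₂.le h₃ (by norm_num))
      (frac_le 114787008 strainD3_pos h₂.le h₃ (by norm_num))
      (frac_ge 4222225728 strainD1_pos h₂.le h₃ (by norm_num))
      (frac_ge 467791632 strainD2_pos h₂.le h₃ (by norm_num))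
      (frac_ge 0 strainD3_pos h₂.le h₃ (by norm_num))
      (frac_le 2207229696 strainD1_pos h₂.le h₃ (by norm_num))
      (frac_le 793828224 strainD2_pos h₂.le h₃ (by norm_num))
      (frac_le 4762969344 strainD3_pos h₂.le h₃ (by norm_num)) (by norm_num)
  · -- piece `[63/40, 8/5]`
    exact form_le (U₁ := -16) (U₂ := -93) (U₃ := -612) (U₄ := -46) (U₅ := 506) (U₆ := -524)
      (L₄ := -52) (L₅ := 485) (L₆ := -633) (U₇ := -91) (U₈ := -48) (U₉ := -426) (B := 200)
      (hS₁₁ t) (hS₁₂ t) (hS₂₂ t)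
      (frac_le 0 strainD1_pos h₃.le ht.2 (by norm_num)) (frac_le 0 strainD2_pos h₃.le ht.2 (by norm_num))
      (frac_le 0 strainD3_pos h₃.le ht.2 (by norm_num)) (frac_le 0 strainD1_pos h₃.le ht.2 (by norm_num))
      (frac_le 0 strainD2_pos h₃.le ht.2 (by norm_num))
      (frac_le 114787008 strainD3_pos h₃.le ht.2 (by norm_num))
      (frac_ge 4222225728 strainD1_pos h₃.le ht.2 (by norm_num))
      (frac_ge 467791632 strainD2_pos h₃.le ht.2 (by norm_num))
      (frac_ge 0 strainD3_pos h₃.le ht.2 (by norm_num))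
      (frac_le 2207229696 strainD1_pos h₃.le ht.2 (by norm_num))
      (frac_le 793828224 strainD2_pos h₃.le ht.2 (by norm_num))
      (frac_le 4762969344 strainD3_pos h₃.le ht.2 (by norm_num)) (by norm_num)

end Summit.NavierStokesRegularity.NavierStokesRegularity.Theorems
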